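import Literature.Analysis.FluidPDE.TurbPassiveScalar
import Literature.Analysis.FluidPDE.DEIJTheorem2
import Literature.Analysis.FluidPDE.ScalarSpectralPoincare
import HarnessLib

/-!
# Anomalous dissipation for passive scalars (turb.S21–S22) — proofs

* `deij_anomalous_dissipation_of_eventually`: the inventory (`limsup`) form turb.S21
  `deij_anomalous_dissipation` (`∃` a null sequence `κⱼ` along which eventually
  `c‖θ₀‖² ≤ κⱼ∫‖∇θⱼ‖²`) follows from the "all sufficiently small `κ`" form
  `deij_anomalous_dissipation_eventually` (`∀` null sequences), with the same field `u(θ₀)` and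
  rate `c(θ₀)`: take `κⱼ = 1/(j+1)` (Drivas–Elgindi–Iyer–Jeong, ARMA 243 (2022), Thm. 2: the
  printed (1.5) is the `∀`-reading, the inventory's `limsup` is the weaker one).
* `armstrong_vicol_eventually_of_armstrong_vicol`: the per-datum form turb.S22
  `armstrong_vicol_eventually` (`∀ θ₀, ∃ c(θ₀) > 0, ∀ᶠ j`) follows from the length-scale-class
  form `armstrong_vicol` (`∀ R, ∃ c_R > 0, ∀ j`, uniformly over the data with
  `‖∇θ₀‖²_{L²} ≤ R ‖θ₀‖²_{L²}`), as announced in the docstring of `armstrong_vicol_eventually`: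
  take `R = ‖∇θ₀‖²_{L²} / ‖θ₀‖²_{L²}`, which is finite for `θ₀ ∈ H¹(T^d)` because
  `|θ₀|_{Ḣ¹} ≤ ‖θ₀‖_{H¹} < ∞` (termwise `|k|² ≤ ⟨k⟩²`); the case `‖θ₀‖_{L²} = 0` is trivial (any
  `c > 0`).
* `deij_anomalous_dissipation_eventually_holds` (**discharge of turb.S21**, 2026-08-16): the
  "all sufficiently small `κ`" form — in fact every `κ > 0` and every weak solution — from
  `Torus.DEIJ.deij_theorem2` (`DEIJTheorem2`, with `DEIJCriterion`, `DEIJShearStage`,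
  `DEIJStageStep`, `DEIJCascade`, `DEIJCascadeGrowth`, `DEIJCascadeRegularity`,
  `DEIJCascadeMain`): Drivas–Elgindi–Iyer–Jeong's alternating sawtooth-shear cascade (ARMA 243
  (2022), §3.3, with the smooth modification of Remark 3.1) run in general dimension from a
  Fourier truncation of the datum, the phase of each shear chosen by an `L²` average instead of
  the `W^{1,∞}` bootstrap of Lemma 3.2, and the balanced-growth criterion proved for weak
  solutions by duality in place of Prop. 1.3; hence also `deij_anomalous_dissipation` by
  `deij_anomalous_dissipation_of_eventually`.
* `deij_anomalous_dissipation_holds` (**discharge of the inventory form of turb.S21**,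
  2026-08-16): `deij_anomalous_dissipation_of_eventually` applied to
  `deij_anomalous_dissipation_eventually_holds`.
* `armstrong_vicol_of_thm11_full`, `thm11_full_of_rmk54` (2026-08-26): the printed form
  `ArmstrongVicol2025_thm11_full` of Armstrong–Vicol's Thm. 1.1 (carrier
  `C⁰_t C^{0,α}_x ∩ C^{0,α}_t C⁰_x`, `1`-periodic; lower bound for every `κ` in the disjoint
  intervals `[κⱼ/2, 2κⱼ]`) implies `armstrong_vicol` (period `τ = 1`, `κ = κⱼ ∈ [κⱼ/2, 2κⱼ]`), and
  `ArmstrongVicol2025_rmk54` (the same clauses plus Remark 5.4) implies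
  `ArmstrongVicol2025_thm11_full` (drop the last clause); bookkeeping for the clause predicate
  `ArmstrongVicol2025.DissipatesAlongIntervals`: the lacunarity `4κⱼ₊₁ < κⱼ` typed there gives
  `StrictAnti κ` (`.strictAnti`) and pairwise disjoint intervals (`.disjoint_Icc`), i.e. the
  printed "sequence of disjoint intervals `Iⱼ := [½κⱼ, 2κⱼ]` with `κⱼ → 0`" (AV, remark after
  (1.6), p. 3), and `κⱼ ∈ Iⱼ` (`.self_mem_Icc`).
* The explicit rate (1.6) (2026-08-26): `Torus.exists_lengthScale` — a non-zero mean-zero `H¹`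
  scalar has a length scale `ℓ = ‖θ₀‖_{L²}/‖∇θ₀‖_{L²} > 0`, `ℓ² ≤ 1/(4π²)` (private plumbing:
  finiteness of the spectral gradient norm of an `H¹` datum, `H¹ ⊆ L²`; and the spectral Poincaré
  inequality for mean-zero scalars, `Torus.ofReal_scalarL2Sq_le_eScalarGradNormSq_of_hasZeroMean`,
  the inequality AV use on p. 90); `ArmstrongVicol2025.DissipatesAtRate.dissipatesAlongIntervals`
  (with the private step `1/(1+R) ≤ ℓ²/(1+ℓ²)` on the class `‖∇θ₀‖² ≤ R‖θ₀‖²`) — the rate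
  clause `ϱ = c (‖θ₀‖_{L²}/‖θ₀‖_{H¹})^p` with one `c` for all data gives the class-uniform clause
  of `ArmstrongVicol2025.DissipatesAlongIntervals` with `c_R = c² (1+R)^{-p}` (AV p. 3: "`ϱ(d,θ₀)`
  depends only on `d` and a lower bound for the length scale"); `thm11_full_of_thm11_rate`
  (`ArmstrongVicol2025_thm11_rate → ArmstrongVicol2025_thm11_full`, `ε = 1`).

**Source check (recorded 2026-08-15) and correction (2026-08-16).** As transcribed at M5 both
turb.S22 facts quantified the dissipation constant `c` *before* the datum (resp. before the bound
`R`). The source is weaker on this point: Armstrong–Vicol, Ann. PDE 11 (2025), Thm. 1.1 states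
`limsup_{κ → 0} κ ‖∇θ^κ‖²_{L²((0,1)×T^d)} ≥ ϱ² ‖θ₀‖²_{L²}` "for some constant `ϱ = ϱ(d, θ₀) ∈ (0,1]`
which depends only on `d` and the ratio `‖θ₀‖_{L²} / ‖∇θ₀‖_{L²}`", quantitatively ((1.6))
`ϱ = c(d, ε) (‖θ₀‖_{L²} / ‖θ₀‖_{H¹})^{(1+α)/(1-α)+ε}`; the explicit subsequence `κⱼ → 0` does not
depend on `θ₀` (remark following (1.6)), but the rate does, and the proof (§5.4: the renormalised
diffusivities are homogenised from the diffusive scale up to the analyticity scale of the datum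
only) yields no rate uniform in the datum's length scale. Both facts were restated in the printed
form on 2026-08-16 (verdict clean-up of `TurbPassiveScalar.lean`): `∀ R, ∃ c_R > 0, ∀ j` (class
version) resp. `∀ θ₀, ∃ c(θ₀) > 0` (per datum), with `0 < α`; the implication below is the same
argument between the corrected forms.

## References

* T. D. Drivas, T. M. Elgindi, G. Iyer, I.-J. Jeong, *Anomalous dissipation in passive scalar
  transport*, Arch. Ration. Mech. Anal. 243 (2022), 1151–1180 (arXiv:1911.03271), Thm. 2,
  Prop. 1.3, §3. [`DrivasEtAl2022`]
* S. Armstrong, V. Vicol, *Anomalous diffusion by fractal homogenization*, Ann. PDE 11 (2025),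
  no. 1, Paper No. 2 (doi:10.1007/s40818-024-00189-6; arXiv:2305.05048), Thm. 1.1, (1.6).
-/

open MeasureTheory Set Filter Topology
open scoped ENNReal NNReal

namespace Literature.Analysis.FluidPDE

variable {d : Type*} [Fintype d]

/-- turb.S22: the per-datum form `armstrong_vicol_eventually` follows from the uniform-class form
`armstrong_vicol` with `R = ‖∇θ₀‖²_{L²} / ‖θ₀‖²_{L²}` (finite for `θ₀ ∈ H¹`, as
`|θ₀|_{Ḣ¹} ≤ ‖θ₀‖_{H¹}`; `‖θ₀‖_{L²} = 0` is trivial), exactly as stated in the docstring of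
`armstrong_vicol_eventually` (Armstrong–Vicol, Ann. PDE 11 (2025), Thm. 1.1, per-datum reading).
See the module docstring for the comparison of both facts with the printed Thm. 1.1 / (1.6). [cite: ArmstrongVicol2025, Thm. 1.1] -/
theorem armstrong_vicol_eventually_of_armstrong_vicol (h : armstrong_vicol (d := d)) :
    armstrong_vicol_eventually (d := d) := by
  intro hd α hα₀ hα
  obtain ⟨u, hper, hcont, hdiv, κ, hκ, hκ0, hR⟩ := h hd α hα₀ hα
  refine ⟨u, hper, hcont, hdiv, κ, hκ, hκ0, fun θ₀ hH1 hmean => ?_⟩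
  by_cases hL : Torus.scalarL2Sq θ₀ ≤ 0
  · -- `‖θ₀‖_{L²} = 0`: the lower bound is `0`, any positive constant does
    refine ⟨1, one_pos, Eventually.of_forall fun j θ _ => ?_⟩
    rw [ENNReal.ofReal_eq_zero.2 (by simpa using hL)]
    exact zero_le
  · push Not at hL
    -- the spectral gradient norm of an `H¹` datum is finite: `|θ₀|²_{Ḣ¹} ≤ ‖θ₀‖²_{H¹} < ∞`
    have hHom : FunctionSpaces.Torus.eHomSobolevSeminorm 1 (fun x => (θ₀ x : ℂ)) ≤
        FunctionSpaces.Torus.eSobolevNorm 1 (fun x => (θ₀ x : ℂ)) := by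
      unfold FunctionSpaces.Torus.eHomSobolevSeminorm FunctionSpaces.Torus.eSobolevNorm
      gcongr with k
      split_ifs with hk
      · exact bot_le
      · apply ENNReal.ofReal_le_ofReal
        have h0 : 0 ≤ 1 + FunctionSpaces.Torus.freqNormSq k := by
          linarith [FunctionSpaces.Torus.freqNormSq_nonneg k]
        rw [FunctionSpaces.Torus.sobolevWeight, ← Real.rpow_natCast, ← Real.rpow_mul h0, Real.rpow_one]
        norm_num
    have hG : Torus.eScalarGradNormSq θ₀ < ∞ := by
      unfold Torus.eScalarGradNormSq
      refine ENNReal.mul_lt_top ENNReal.ofReal_lt_top ?_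
      exact ENNReal.pow_lt_top (lt_of_le_of_lt hHom hH1.eSobolevNorm_lt_top)
    set L := ENNReal.ofReal (Torus.scalarL2Sq θ₀) with hLdef
    have hL0 : L ≠ 0 := by simpa [hLdef, ENNReal.ofReal_eq_zero, not_le] using hL
    have hLtop : L ≠ ∞ := ENNReal.ofReal_ne_top
    have hQ : Torus.eScalarGradNormSq θ₀ / L ≠ ∞ := (ENNReal.div_lt_top hG.ne hL0).ne
    have hratio : Torus.eScalarGradNormSq θ₀ ≤
        ((Torus.eScalarGradNormSq θ₀ / L).toNNReal : ℝ≥0∞) * ENNReal.ofReal (Torus.scalarL2Sq θ₀) := by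
      rw [ENNReal.coe_toNNReal hQ, ENNReal.div_mul_cancel hL0 hLtop]
    -- the class constant `c_R` for `R = ‖∇θ₀‖² / ‖θ₀‖²` serves as `c(θ₀)`, for every `j`
    obtain ⟨c, hc, hj⟩ := hR (Torus.eScalarGradNormSq θ₀ / L).toNNReal
    exact ⟨c, hc, Eventually.of_forall fun j θ hθ => hj j θ₀ hH1 hmean hratio θ hθ⟩

variable [DecidableEq d] in
/-- turb.S21: the inventory (`limsup`) form `deij_anomalous_dissipation` follows from the
"for all sufficiently small `κ`" form `deij_anomalous_dissipation_eventually` with the same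
velocity field and rate, along the null sequence `κⱼ = 1/(j+1)` (Drivas–Elgindi–Iyer–Jeong,
Arch. Ration. Mech. Anal. 243 (2022), Thm. 2: (1.5) for all small `κ` implies the `limsup`
statement of the inventory). [cite: DrivasEtAl2022, Thm. 2] -/
theorem deij_anomalous_dissipation_of_eventually (h : deij_anomalous_dissipation_eventually (d := d)) :
    deij_anomalous_dissipation (d := d) := by
  intro hd α hα T hT θ₀ hH2 hmean
  obtain ⟨u, hs, hdiv, hcont, hL1, hbdd, c, hc, hall⟩ := h hd α hα T hT θ₀ hH2 hmean
  have hpos : ∀ j : ℕ, (0 : ℝ) < 1 / ((j : ℝ) + 1) := fun j => by positivity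
  exact ⟨u, hs, hdiv, hcont, hL1, hbdd, c, hc, fun j => 1 / ((j : ℝ) + 1), hpos,
    tendsto_one_div_add_atTop_nhds_zero_nat, fun θ hθ => hall _ hpos tendsto_one_div_add_atTop_nhds_zero_nat θ hθ⟩

variable [DecidableEq d] in
/-- **Discharge of turb.S21 (`deij_anomalous_dissipation_eventually`)**: Drivas–Elgindi–Iyer–Jeong,
Arch. Ration. Mech. Anal. 243 (2022), Thm. 2, in the "for all sufficiently small `κ`" reading —
indeed for every `κ > 0` and every weak solution: `Torus.DEIJ.deij_theorem2` (`DEIJTheorem2`: the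
alternating smoothed-sawtooth shear cascade of §3.3 run from a Fourier truncation of the datum,
the balanced-growth criterion `Torus.DEIJ.le_eScalarDissipation_of_balanced_growth` of
`DEIJCriterion` replacing Prop. 1.3 for weak solutions). [cite: DrivasEtAl2022, Thm. 2] -/
theorem deij_anomalous_dissipation_eventually_holds : deij_anomalous_dissipation_eventually (d := d) := by
  intro hd α hα T hT θ₀ hH2 hmean
  obtain ⟨u, hs, hdiv, hcont, hL1, hbdd, c, hc, hall⟩ := Torus.DEIJ.deij_theorem2 hd α hα T hT θ₀ hH2 hmean
  exact ⟨u, hs, hdiv, hcont, hL1, hbdd, c, hc, fun κ hκ _ θ hθ =>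
    Eventually.of_forall fun j => hall (κ j) (hκ j) (θ j) (hθ j)⟩

variable [DecidableEq d] in
/-- **Discharge of the inventory form of turb.S21 (`deij_anomalous_dissipation`)**:
Drivas–Elgindi–Iyer–Jeong, Arch. Ration. Mech. Anal. 243 (2022), Thm. 2, `limsup` reading along
the null sequence `κⱼ = 1/(j+1)`: immediate from the "all sufficiently small `κ`" form
`deij_anomalous_dissipation_eventually_holds` and the bridge
`deij_anomalous_dissipation_of_eventually`. [cite: DrivasEtAl2022, Thm. 2] -/
theorem deij_anomalous_dissipation_holds : deij_anomalous_dissipation (d := d) :=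
  deij_anomalous_dissipation_of_eventually deij_anomalous_dissipation_eventually_holds

/-! ## Armstrong–Vicol, Thm. 1.1 in its printed form: corollaries and bookkeeping (2026-08-26) -/

namespace ArmstrongVicol2025

variable {u : ℝ → UnitAddTorus d → EuclideanSpace ℝ d} {κ : ℕ → ℝ}

/-- The lacunarity clause `4κⱼ₊₁ < κⱼ` of `DissipatesAlongIntervals` (with `0 < κⱼ₊₁`) makes the
sequence of diffusivities strictly decreasing — AV's "`κⱼ ↓ 0`" (p. 3). [cite: ArmstrongVicol2025, Thm. 1.1 and the remarks following (1.6), p. 3] -/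
theorem DissipatesAlongIntervals.strictAnti (h : DissipatesAlongIntervals u κ) : StrictAnti κ := by
  refine strictAnti_nat_of_succ_lt fun j => ?_
  linarith [h.1 (j + 1), h.2.1 j]

/-- The lacunarity clause `4κⱼ₊₁ < κⱼ` of `DissipatesAlongIntervals` (with positivity) makes the
closed intervals `Iⱼ = [κⱼ/2, 2κⱼ]` pairwise disjoint — AV's "sequence of disjoint intervals
`Iⱼ := [½κⱼ, 2κⱼ]`" (remark after (1.6), p. 3): for `j < i` one has `2κᵢ < κⱼ/2` by induction
on `i`. [cite: ArmstrongVicol2025, remark following (1.6), p. 3] -/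
theorem DissipatesAlongIntervals.disjoint_Icc (h : DissipatesAlongIntervals u κ) :
    Pairwise (Function.onFun Disjoint fun j => Icc (κ j / 2) (2 * κ j)) := by
  have hpos := h.1
  have hsep := h.2.1
  -- `2 κ i < κ j / 2` whenever `j < i`
  have key : ∀ {i j : ℕ}, j < i → 2 * κ i < κ j / 2 := by
    intro i j hij
    induction i with
    | zero => exact absurd hij (Nat.not_lt_zero _)
    | succ i ih =>
      rcases Nat.lt_succ_iff_lt_or_eq.1 hij with hlt | rfl
      · have := ih hlt
        linarith [hsep i, hpos i, hpos (i + 1)]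
      · linarith [hsep j, hpos (j + 1)]
  intro i j hij
  rcases lt_or_gt_of_ne hij with hlt | hgt
  · rw [Function.onFun, Set.disjoint_iff]
    intro x ⟨hi, hj⟩
    simp only [mem_Icc] at hi hj
    linarith [key hlt]
  · rw [Function.onFun, Set.disjoint_iff]
    intro x ⟨hi, hj⟩
    simp only [mem_Icc] at hi hj
    linarith [key hgt]

/-- The centre `κⱼ > 0` lies in its interval `Iⱼ = [κⱼ/2, 2κⱼ]`, so every statement "for all
`κ ∈ ⋃ⱼ Iⱼ`" specialises to the sequence `κⱼ` itself (used for `armstrong_vicol`). [cite: ArmstrongVicol2025, remark following (1.6), p. 3] -/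
theorem DissipatesAlongIntervals.self_mem_Icc (h : DissipatesAlongIntervals u κ) (j : ℕ) :
    κ j ∈ Icc (κ j / 2) (2 * κ j) := by
  constructor <;> linarith [h.1 j]

end ArmstrongVicol2025

/-- turb.S22: `armstrong_vicol` (some period `τ > 0`, `C⁰_t C^{0,α}_x`, weakly divergence free,
datum-independent `κⱼ → 0`, class-uniform constant, bound at `κ = κⱼ`) follows from the printed
form `ArmstrongVicol2025_thm11_full` of the same Thm. 1.1: forget the time-Hölder clause, take
`τ = 1`, and specialise "every `κ ∈ [κⱼ/2, 2κⱼ]`" to the centre `κⱼ`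
(`DissipatesAlongIntervals.self_mem_Icc`). [cite: ArmstrongVicol2025, Thm. 1.1 with (1.6) and the remarks following it, p. 3] -/
theorem armstrong_vicol_of_thm11_full (h : ArmstrongVicol2025_thm11_full (d := d)) :
    armstrong_vicol (d := d) := by
  intro hd α hα₀ hα
  obtain ⟨u, ⟨hper, hcont, -, hdiv⟩, κ, hκ⟩ := h hd α hα₀ hα
  have hmem := hκ.self_mem_Icc
  obtain ⟨hpos, -, hκ0, hR⟩ := hκ
  refine ⟨u, ⟨1, one_pos, hper⟩, hcont, hdiv, κ, hpos, hκ0, fun R => ?_⟩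
  obtain ⟨c, hc, hj⟩ := hR R
  exact ⟨c, hc, fun j θ₀ hH1 hmean hratio θ hθ => hj j (κ j) (hmem j) θ₀ hH1 hmean hratio θ hθ⟩

/-- turb.S22: the Remark 5.4 fact `ArmstrongVicol2025_rmk54` carries all clauses of the printed
Thm. 1.1, so `ArmstrongVicol2025_thm11_full` follows by dropping the time-Hölder clause
`IsTimeHolderAlong`. [cite: ArmstrongVicol2025, Remark 5.4 p. 93; Thm. 1.1 p. 3] -/
theorem thm11_full_of_rmk54 (h : ArmstrongVicol2025_rmk54 (d := d)) :
    ArmstrongVicol2025_thm11_full (d := d) := by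
  intro hd α hα₀ hα
  obtain ⟨u, hu, κ, hκ, -⟩ := h hd α hα₀ hα
  exact ⟨u, hu, κ, hκ⟩

/-- turb.S22, chained: the per-datum form `armstrong_vicol_eventually` from the printed form of
Thm. 1.1. [cite: ArmstrongVicol2025, Thm. 1.1 p. 3] -/
theorem armstrong_vicol_eventually_of_thm11_full (h : ArmstrongVicol2025_thm11_full (d := d)) :
    armstrong_vicol_eventually (d := d) :=
  armstrong_vicol_eventually_of_armstrong_vicol (armstrong_vicol_of_thm11_full h)

/-! ## The length scale of a mean-zero `H¹` scalar, and AV's explicit rate (1.6) (2026-08-26)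

Bookkeeping for the clause predicate `ArmstrongVicol2025.DissipatesAtRate` and the fact
`ArmstrongVicol2025_thm11_rate` (Armstrong–Vicol, Ann. PDE 11 (2025), (1.6) p. 3): the length
scale `ℓ = ‖θ₀‖_{L²}/‖∇θ₀‖_{L²}` of a non-zero mean-zero `H¹` scalar exists (the spectral gradient
norm of an `H¹` datum is finite, and positive by the spectral Poincaré inequality
`Torus.ofReal_scalarVariance_le_eScalarGradNormSq`, which also gives `ℓ² ≤ 1/(4π²)`); the
explicit rate `ϱ = c (ℓ²/(1+ℓ²))^{p/2}` with one `c` for all data yields, on every length-scale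
class `‖∇θ₀‖² ≤ R‖θ₀‖²` (`ℓ² ≥ 1/R`), the class constant `c² (1+R)^{-p}` of
`ArmstrongVicol2025.DissipatesAlongIntervals` — the printed "In particular, `ϱ(d,θ₀)` depends only
on `d` and a lower bound for the length scale `‖θ₀‖_{L²}/‖∇θ₀‖_{L²}`" (p. 3). -/

namespace Torus

/-- The spectral gradient norm `‖∇θ₀‖²_{L²}` of an `H¹(T^d)` scalar is finite:
`|θ₀|²_{Ḣ¹} ≤ ‖θ₀‖²_{H¹} < ∞` (termwise `|k|² ≤ ⟨k⟩²`; private plumbing). [folklore] -/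
private theorem eScalarGradNormSq_lt_top_of_memSobolev {θ₀ : UnitAddTorus d → ℝ}
    (h : FunctionSpaces.Torus.MemSobolev 1 (fun x => (θ₀ x : ℂ))) : eScalarGradNormSq θ₀ < ∞ := by
  have hHom : FunctionSpaces.Torus.eHomSobolevSeminorm 1 (fun x => (θ₀ x : ℂ)) ≤
      FunctionSpaces.Torus.eSobolevNorm 1 (fun x => (θ₀ x : ℂ)) := by
    unfold FunctionSpaces.Torus.eHomSobolevSeminorm FunctionSpaces.Torus.eSobolevNorm
    gcongr with k
    split_ifs with hk
    · exact bot_le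
    · apply ENNReal.ofReal_le_ofReal
      have h0 : 0 ≤ 1 + FunctionSpaces.Torus.freqNormSq k := by
        linarith [FunctionSpaces.Torus.freqNormSq_nonneg k]
      rw [FunctionSpaces.Torus.sobolevWeight, ← Real.rpow_natCast, ← Real.rpow_mul h0, Real.rpow_one]
      norm_num
  unfold eScalarGradNormSq
  refine ENNReal.mul_lt_top ENNReal.ofReal_lt_top ?_
  exact ENNReal.pow_lt_top (lt_of_le_of_lt hHom h.eSobolevNorm_lt_top)

/-- An `H¹(T^d)` real scalar (membership through its complexification, the convention of
`armstrong_vicol`) is square integrable (`H¹ ⊆ L²`, `Torus.MemSobolev.memLp_two_holds`, and the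
real part of the complexification is the scalar; private plumbing). [folklore] -/
private theorem memLp_two_of_memSobolev_one {θ₀ : UnitAddTorus d → ℝ}
    (h : FunctionSpaces.Torus.MemSobolev 1 (fun x => (θ₀ x : ℂ))) : MemLp θ₀ 2 volume := by
  have hc : MemLp (fun x => (θ₀ x : ℂ)) 2 volume :=
    FunctionSpaces.Torus.MemSobolev.memLp_two_holds h zero_le_one
  simpa using hc.re

/-- **Spectral Poincaré for mean-zero scalars**: for a mean-zero `θ₀ ∈ L²(T^d)`,
`4π² ‖θ₀‖²_{L²} ≤ ‖∇θ₀‖²_{L²}` in `[0,∞]` (`Torus.ofReal_scalarVariance_le_eScalarGradNormSq` with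
`∫ θ₀ = 0`) — the inequality used in the proof of AV Thm. 1.1 (§5.4 p. 90: "The standard `L²`
energy estimate and the Poincaré inequality are applicable. Since `⟨θ₀⟩ = 0`, we find that
`d/dt ‖θ(t)‖²_{L²(T²)} = -2κ‖∇θ(t)‖²_{L²(T²)} ≤ -8κπ²‖θ(t)‖²_{L²(T²)}`").
[cite: ArmstrongVicol2025, §5.4 p. 90 (Poincaré inequality on the unit torus, display after (5.96))] -/
theorem ofReal_scalarL2Sq_le_eScalarGradNormSq_of_hasZeroMean {θ₀ : UnitAddTorus d → ℝ}
    (hL2 : MemLp θ₀ 2 volume) (hmean : FunctionSpaces.Torus.HasZeroMean θ₀) :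
    ENNReal.ofReal (4 * Real.pi ^ 2 * scalarL2Sq θ₀) ≤ eScalarGradNormSq θ₀ := by
  have h := ofReal_scalarVariance_le_eScalarGradNormSq hL2
  have h0 : (∫ x, θ₀ x) = 0 := hmean
  rw [h0] at h
  simpa [scalarL2Sq] using h

/-- **The length scale of a non-zero mean-zero `H¹` scalar.** For `θ₀ ∈ H¹(T^d)` with zero mean
and `‖θ₀‖_{L²} > 0` there is `ℓ > 0` — the length scale `ℓ = ‖θ₀‖_{L²}/‖∇θ₀‖_{L²}` of
Armstrong–Vicol, Thm. 1.1 ("the ratio `‖θ₀‖_{L²(T^d)}/‖∇θ₀‖_{L²(T^d)}`", p. 3) and of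
Burczak–Székelyhidi–Wu, (1.5) (`ℓ_in`) — with `‖θ₀‖²_{L²} = ℓ² ‖∇θ₀‖²_{L²}` in `[0,∞]` (the
hypothesis form used by `ArmstrongVicol2025.DissipatesAtRate` and
`BurczakSzekelyhidiWu2023_richardsonBound`), and `ℓ² ≤ 1/(4π²)` (Poincaré on the unit torus).
[cite: ArmstrongVicol2025, Thm. 1.1 p. 3] -/
theorem exists_lengthScale {θ₀ : UnitAddTorus d → ℝ}
    (hH1 : FunctionSpaces.Torus.MemSobolev 1 (fun x => (θ₀ x : ℂ)))
    (hmean : FunctionSpaces.Torus.HasZeroMean θ₀) (hpos : 0 < scalarL2Sq θ₀) :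
    ∃ ℓ : ℝ, 0 < ℓ ∧ ℓ ^ 2 ≤ 1 / (4 * Real.pi ^ 2) ∧
      ENNReal.ofReal (scalarL2Sq θ₀) = ENNReal.ofReal (ℓ ^ 2) * eScalarGradNormSq θ₀ := by
  have hG := eScalarGradNormSq_lt_top_of_memSobolev hH1
  have hP := ofReal_scalarL2Sq_le_eScalarGradNormSq_of_hasZeroMean
    (memLp_two_of_memSobolev_one hH1) hmean
  set G := eScalarGradNormSq θ₀ with hGdef
  have hGtop : G ≠ ∞ := hG.ne
  have hPr : 4 * Real.pi ^ 2 * scalarL2Sq θ₀ ≤ G.toReal :=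
    (ENNReal.ofReal_le_iff_le_toReal hGtop).1 hP
  have hπ : 0 < 4 * Real.pi ^ 2 := by positivity
  have hGpos : 0 < G.toReal := lt_of_lt_of_le (by positivity) hPr
  have hq : 0 ≤ scalarL2Sq θ₀ / G.toReal := div_nonneg hpos.le hGpos.le
  refine ⟨Real.sqrt (scalarL2Sq θ₀ / G.toReal), Real.sqrt_pos.2 (div_pos hpos hGpos), ?_, ?_⟩
  · rw [Real.sq_sqrt hq, div_le_div_iff₀ hGpos hπ]
    linarith
  · rw [Real.sq_sqrt hq]
    calc ENNReal.ofReal (scalarL2Sq θ₀)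
        = ENNReal.ofReal (scalarL2Sq θ₀ / G.toReal * G.toReal) := by
          rw [div_mul_cancel₀ _ hGpos.ne']
      _ = ENNReal.ofReal (scalarL2Sq θ₀ / G.toReal) * ENNReal.ofReal G.toReal :=
          ENNReal.ofReal_mul hq
      _ = ENNReal.ofReal (scalarL2Sq θ₀ / G.toReal) * G := by rw [ENNReal.ofReal_toReal hGtop]

/-- From the identity `‖θ₀‖²_{L²} = ℓ² ‖∇θ₀‖²_{L²}` (`ℓ > 0`, `‖θ₀‖_{L²} > 0`) and the class bound
`‖∇θ₀‖²_{L²} ≤ R ‖θ₀‖²_{L²}`: `1 ≤ R ℓ²`, hence `1/(1+R) ≤ ℓ²/(1+ℓ²)` — on the class the ratio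
`‖θ₀‖_{L²}/‖θ₀‖_{H¹}` is bounded below in terms of `R` alone (the remark in the docstring of
`armstrong_vicol`; private plumbing). [folklore] -/
private theorem one_div_add_le_lengthScale_ratio {θ₀ : UnitAddTorus d → ℝ} {ℓ : ℝ} {R : ℝ≥0}
    (hℓ : 0 < ℓ) (hpos : 0 < scalarL2Sq θ₀)
    (hid : ENNReal.ofReal (scalarL2Sq θ₀) = ENNReal.ofReal (ℓ ^ 2) * eScalarGradNormSq θ₀)
    (hR : eScalarGradNormSq θ₀ ≤ (R : ℝ≥0∞) * ENNReal.ofReal (scalarL2Sq θ₀)) :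
    1 / (1 + (R : ℝ)) ≤ ℓ ^ 2 / (1 + ℓ ^ 2) := by
  set G := eScalarGradNormSq θ₀ with hGdef
  have hL0 : ENNReal.ofReal (scalarL2Sq θ₀) ≠ 0 := by
    simpa [ENNReal.ofReal_eq_zero, not_le] using hpos
  have hG0 : G ≠ 0 := by
    intro hG
    exact hL0 (by rw [hid, hG, mul_zero])
  have hGtop : G ≠ ∞ := by
    intro hG
    have hℓ0 : ENNReal.ofReal (ℓ ^ 2) ≠ 0 := (ENNReal.ofReal_pos.2 (pow_pos hℓ 2)).ne'
    have : ENNReal.ofReal (scalarL2Sq θ₀) = ∞ := by rw [hid, hG, ENNReal.mul_top hℓ0]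
    exact ENNReal.ofReal_ne_top this
  -- `G ≤ R ℓ² G`, cancel `G`
  have h1 : (1 : ℝ≥0∞) * G ≤ ENNReal.ofReal ((R : ℝ) * ℓ ^ 2) * G := by
    rw [one_mul, ENNReal.ofReal_mul R.coe_nonneg, ENNReal.ofReal_coe_nnreal, mul_assoc, ← hid]
    exact hR
  have h2 : (1 : ℝ) ≤ (R : ℝ) * ℓ ^ 2 :=
    ENNReal.one_le_ofReal.1 ((ENNReal.mul_le_mul_iff_left hG0 hGtop).1 h1)
  rw [div_le_div_iff₀ (by positivity) (by positivity)]
  nlinarith [h2, sq_nonneg ℓ]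

end Torus

namespace ArmstrongVicol2025

/-- **(1.6) ⇒ the class-uniform constant of Thm. 1.1.** If along the intervals `[κⱼ/2, 2κⱼ]` the
drift `u` dissipates at the explicit rate `ϱ = c (‖θ₀‖_{L²}/‖θ₀‖_{H¹})^{p}` with one `c` for all
data (`DissipatesAtRate p u κ`, `0 ≤ p`), then — with the positivity, lacunarity and null-sequence
clauses — `DissipatesAlongIntervals u κ` holds: on the class `‖∇θ₀‖²_{L²} ≤ R‖θ₀‖²_{L²}` one has
`(‖θ₀‖_{L²}/‖θ₀‖_{H¹})² = ℓ²/(1+ℓ²) ≥ 1/(1+R)`, so `c_R = c² (1+R)^{-p}` serves (Armstrong–Vicol,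
p. 3: "In particular, `ϱ(d,θ₀)` depends only on `d` and a lower bound for the length scale
`‖θ₀‖_{L²(T^d)}/‖∇θ₀‖_{L²(T^d)}`"); data with `‖θ₀‖_{L²} = 0` are trivial, and a non-zero
mean-zero `H¹` datum has a length scale (`Torus.exists_lengthScale`). [cite: ArmstrongVicol2025, eq. (1.6) and the remark following it, p. 3] -/
theorem DissipatesAtRate.dissipatesAlongIntervals {p : ℝ} {u : ℝ → UnitAddTorus d → EuclideanSpace ℝ d}
    {κ : ℕ → ℝ} (hrate : DissipatesAtRate p u κ)
    (hp : 0 ≤ p) (hpos : ∀ j, 0 < κ j) (hlac : ∀ j, 4 * κ (j + 1) < κ j)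
    (hlim : Tendsto κ atTop (𝓝 0)) : DissipatesAlongIntervals u κ := by
  obtain ⟨c, hc, hb⟩ := hrate
  refine ⟨hpos, hlac, hlim, fun R => ⟨c ^ 2 * (1 / (1 + (R : ℝ))) ^ p, by positivity, ?_⟩⟩
  intro j κ' hκ' θ₀ hH1 hmean hR θ hθ
  by_cases hL : Torus.scalarL2Sq θ₀ ≤ 0
  · -- `‖θ₀‖_{L²} = 0`: the lower bound is `0`
    have h0 : c ^ 2 * (1 / (1 + (R : ℝ))) ^ p * Torus.scalarL2Sq θ₀ ≤ 0 :=
      mul_nonpos_of_nonneg_of_nonpos (by positivity) hL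
    rw [ENNReal.ofReal_eq_zero.2 h0]
    exact zero_le
  · push Not at hL
    obtain ⟨ℓ, hℓ, -, hid⟩ := Torus.exists_lengthScale hH1 hmean hL
    have hbase := Torus.one_div_add_le_lengthScale_ratio hℓ hL hid hR
    refine le_trans (ENNReal.ofReal_le_ofReal ?_) (hb j κ' hκ' θ₀ hH1 hmean ℓ hℓ hid θ hθ)
    have hrp : (1 / (1 + (R : ℝ))) ^ p ≤ (ℓ ^ 2 / (1 + ℓ ^ 2)) ^ p :=
      Real.rpow_le_rpow (by positivity) hbase hp
    exact mul_le_mul_of_nonneg_right (mul_le_mul_of_nonneg_left hrp (sq_nonneg c)) hL.le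

end ArmstrongVicol2025

/-- turb.S22: the printed form `ArmstrongVicol2025_thm11_full` of Thm. 1.1 follows from the form
with the explicit rate (1.6), `ArmstrongVicol2025_thm11_rate`, by taking `ε = 1` and dropping the
rate clause. [cite: ArmstrongVicol2025, Thm. 1.1 with eq. (1.6), p. 3] -/
theorem thm11_full_of_thm11_rate (h : ArmstrongVicol2025_thm11_rate (d := d)) :
    ArmstrongVicol2025_thm11_full (d := d) := by
  intro hd α hα₀ hα
  obtain ⟨u, hu, κ, hκ, -⟩ := h hd α hα₀ hα 1 one_pos
  exact ⟨u, hu, κ, hκ⟩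

/-- turb.S22: in `ArmstrongVicol2025_thm11_rate` the clause `DissipatesAlongIntervals` is implied by
the rate clause and the lacunarity data it carries (`(1+α)/(1-α)+ε ≥ 0`): the two conclusions of
the fact are consistent, the first being the printed corollary of the second
(`ArmstrongVicol2025.DissipatesAtRate.dissipatesAlongIntervals`). [cite: ArmstrongVicol2025, eq. (1.6) and the remark following it, p. 3] -/
theorem ArmstrongVicol2025.DissipatesAtRate.dissipatesAlongIntervals_of_exponent {α : ℝ≥0} {ε : ℝ}
    (hα : α < 1 / 3) (hε : 0 < ε) {u : ℝ → UnitAddTorus d → EuclideanSpace ℝ d} {κ : ℕ → ℝ}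
    (hrate : ArmstrongVicol2025.DissipatesAtRate ((1 + (α : ℝ)) / (1 - α) + ε) u κ)
    (hpos : ∀ j, 0 < κ j) (hlac : ∀ j, 4 * κ (j + 1) < κ j) (hlim : Tendsto κ atTop (𝓝 0)) :
    ArmstrongVicol2025.DissipatesAlongIntervals u κ := by
  refine hrate.dissipatesAlongIntervals ?_ hpos hlac hlim
  have hα' : (α : ℝ) < 1 / 3 := by exact_mod_cast hα
  have h1 : 0 < 1 - (α : ℝ) := by linarith
  have h2 : 0 ≤ (1 + (α : ℝ)) / (1 - α) := div_nonneg (by positivity) h1.le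
  linarith

end Literature.Analysis.FluidPDE
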